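import Literature.Computability.AlgebraicComplexity.SymmetricCircuitLinCombSymmetry
import Mathlib.Data.Fintype.Sum
import HarnessLib

/-!
# Symmetric circuits: output-wise linear combinations of two output families (the circuit)

Topic `Computability/AlgebraicComplexity`, namespace `Literature.Computability.AlgebraicComplexity`.

A closure property of Dawar–Wilsenach symmetric arithmetic circuits
(`SymmetricArithCircuit.lean`: `LabelledArithCircuit` = Def. 2.2, `IsAutomorphismExtending` =
Def. 3.6, `IsSymmetric` = Def. 3.7 of A. Dawar, G. Wilsenach, *Symmetric Arithmetic Circuits*,
Theory of Computing 21 (2025)), the MULTI-OUTPUT version of `SymmetricCircuitLinComb.lean`: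
from a `Γ`-symmetric labelled circuit `P` whose outputs are indexed by a `Γ`-set `Y₀`, two
`Γ`-equivariant index maps `l r : Y → Y₀` from a `Γ`-set `Y` (typically `Y₀ = Y ⊕ Y`,
`l = Sum.inl`, `r = Sum.inr`: two equivariant output families `A_y`, `B_y` delivered by one
circuit) and two constants `a, b ∈ K`, one gets a `Γ`-symmetric circuit with outputs indexed by
`Y` computing `y ↦ a · out_{l y} + b · out_{r y}` (matrix sums and differences, `c · I + M`, …)
with at most `|G| + 3 · |Y| + 4` gates. This file builds the post-composition gadget
(`LabelledArithCircuit.LinCombOutputs.circuit`) and proves its semantics; symmetry, size and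
the packaged statement `LabelledArithCircuit.IsSymmetric.exists_linCombOutputs` are in
`SymmetricCircuitLinCombOutputsSymmetry.lean`.

Gates (`LinCombOutGate`): the old gates of `P`; NEW constant gates only for those of `a, b` that
are not already the label of a (constant) gate of `P` (Def. 2.2 demands injective labels on input
gates, so existing constant gates are reused — the constant set `LinComb.cset a b`, the type of
missing constants `LinComb.NC P a b` of `SymmetricCircuitLinComb.lean`, and the sources `csrc`);
two unary addition gates `sa`, `sb` over the sources of `a`, `b` (values `a`, `b`; being fresh
they never coincide with an old output gate, which keeps the products binary); and, for every
`y ∈ Y`, two multiplication gates `ma y = sa × out_{l y}`, `mb y = sb × out_{r y}` and the output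
`out y = ma y + mb y`. Everything is folklore and proved; nothing here is a named fact.
-/

noncomputable section

open scoped Classical

namespace Literature.Computability.AlgebraicComplexity

open MvPolynomial

universe u v w z z₀

/-! ### Gates -/

/-- Gates of the output-wise linear-combination circuit over a circuit with gate type `G` and new
output index type `Y`: the old gates, new constant gates (`NC`), the unary sums `sa`, `sb` (values
`a`, `b`) and, for each `y`, the products `ma y = sa × out_{l y}`, `mb y = sb × out_{r y}` and the
output `out y = ma y + mb y`. [cite: DawarWilsenach2025, Def. 2.2] -/
inductive LinCombOutGate (G : Type w) (NC : Type u) (Y : Type z) : Type (max u w z)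
  /-- An old gate. -/
  | old (g : G) : LinCombOutGate G NC Y
  /-- A new constant gate. -/
  | ncst (c : NC) : LinCombOutGate G NC Y
  /-- The unary sum over the source of `a`. -/
  | sa : LinCombOutGate G NC Y
  /-- The unary sum over the source of `b`. -/
  | sb : LinCombOutGate G NC Y
  /-- The product `a × out_{l y}`. -/
  | ma (y : Y) : LinCombOutGate G NC Y
  /-- The product `b × out_{r y}`. -/
  | mb (y : Y) : LinCombOutGate G NC Y
  /-- The output `a · out_{l y} + b · out_{r y}`. -/
  | out (y : Y) : LinCombOutGate G NC Y

namespace LinCombOutGate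

variable {G : Type w} {NC : Type u} {Y : Type z}

/-- The gates as a sum type (for counting). [cite: DawarWilsenach2025, Def. 2.2 (size)] -/
def equivSum : LinCombOutGate G NC Y ≃ (G ⊕ NC ⊕ Bool) ⊕ (Y ⊕ Y ⊕ Y) where
  toFun
    | old g => Sum.inl (Sum.inl g)
    | ncst c => Sum.inl (Sum.inr (Sum.inl c))
    | sa => Sum.inl (Sum.inr (Sum.inr false))
    | sb => Sum.inl (Sum.inr (Sum.inr true))
    | ma y => Sum.inr (Sum.inl y)
    | mb y => Sum.inr (Sum.inr (Sum.inl y))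
    | out y => Sum.inr (Sum.inr (Sum.inr y))
  invFun
    | Sum.inl (Sum.inl g) => old g
    | Sum.inl (Sum.inr (Sum.inl c)) => ncst c
    | Sum.inl (Sum.inr (Sum.inr false)) => sa
    | Sum.inl (Sum.inr (Sum.inr true)) => sb
    | Sum.inr (Sum.inl y) => ma y
    | Sum.inr (Sum.inr (Sum.inl y)) => mb y
    | Sum.inr (Sum.inr (Sum.inr y)) => out y
  left_inv g := by cases g <;> rfl
  right_inv t := by rcases t with (g | c | (_ | _)) | (y | y | y) <;> rfl

/-- Finitely many gates over finitely many old gates, constants and output indices.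
[cite: DawarWilsenach2025, Def. 2.2 (size)] -/
instance instFintype [Fintype G] [Fintype NC] [Fintype Y] : Fintype (LinCombOutGate G NC Y) :=
  Fintype.ofEquiv _ equivSum.symm

/-- `old` is injective. [cite: DawarWilsenach2025, Def. 2.2] -/
theorem old_injective : Function.Injective (old : G → LinCombOutGate G NC Y) := by
  intro g g' h; cases h; rfl

/-- `old` as an embedding (to map children sets). [cite: DawarWilsenach2025, Def. 2.2] -/
def oldEmb : G ↪ LinCombOutGate G NC Y := ⟨old, old_injective⟩

/-- `oldEmb` is `old`. [cite: DawarWilsenach2025, Def. 2.2] -/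
@[simp] theorem oldEmb_apply (g : G) : (oldEmb : G ↪ LinCombOutGate G NC Y) g = old g := rfl

/-- Relabelling the old gates by `π` and the output layers by `σ`, fixing the constant gates and
`sa`, `sb`. [cite: DawarWilsenach2025, Def. 3.6] -/
def perm (π : Equiv.Perm G) (σ : Equiv.Perm Y) : Equiv.Perm (LinCombOutGate G NC Y) where
  toFun
    | old g => old (π g)
    | ncst c => ncst c
    | sa => sa
    | sb => sb
    | ma y => ma (σ y)
    | mb y => mb (σ y)
    | out y => out (σ y)
  invFun
    | old g => old (π.symm g)
    | ncst c => ncst c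
    | sa => sa
    | sb => sb
    | ma y => ma (σ.symm y)
    | mb y => mb (σ.symm y)
    | out y => out (σ.symm y)
  left_inv g := by cases g <;> simp
  right_inv g := by cases g <;> simp

end LinCombOutGate

/-! ### The construction -/

namespace LabelledArithCircuit

namespace LinCombOutputs

variable {K : Type u} {X : Type v} {Y₀ : Type z₀} {Y : Type z} {G : Type w}
  (P : LabelledArithCircuit K X Y₀ G) (Y) (l r : Y → Y₀) (a b : K)

/-- The gate type of the output-wise linear-combination circuit (missing constants
`LinComb.NC P a b ⊆ {a, b}` as in `SymmetricCircuitLinComb.lean`). [cite: DawarWilsenach2025, Def. 2.2] -/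
abbrev Gate : Type (max u w z) := LinCombOutGate G (LinComb.NC P a b) Y

variable {P Y a b}

/-- The gate sourcing the constant `c ∈ {a, b}`: the old gate labelled `c` if there is one, else
the new one. [cite: DawarWilsenach2025, Def. 2.2] -/
def csrc (c : K) (hc : c ∈ LinComb.cset a b) : Gate P Y a b :=
  if h : ∃ g, P.label g = .const c then .old h.choose else .ncst ⟨c, hc, not_exists.mp h⟩

variable (P a b)

/-- Children in the output-wise linear-combination circuit (module docstring).
[cite: DawarWilsenach2025, Def. 2.2] -/
def children : Gate P Y a b → Finset (Gate P Y a b)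
  | .old g => (P.children g).map LinCombOutGate.oldEmb
  | .ncst _ => ∅
  | .sa => {csrc a (LinComb.mem_cset a b).1}
  | .sb => {csrc b (LinComb.mem_cset a b).2}
  | .ma y => {LinCombOutGate.sa, LinCombOutGate.old (P.output (l y))}
  | .mb y => {LinCombOutGate.sb, LinCombOutGate.old (P.output (r y))}
  | .out y => {LinCombOutGate.ma y, LinCombOutGate.mb y}

/-- Labels in the output-wise linear-combination circuit. [cite: DawarWilsenach2025, Def. 2.2] -/
def label : Gate P Y a b → CircuitLabel K X
  | .old g => P.label g
  | .ncst c => .const c.1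
  | .sa => .add
  | .sb => .add
  | .ma _ => .mul
  | .mb _ => .mul
  | .out _ => .add

variable {P l r a b}

/-- `csrc c` is labelled `c`. [cite: DawarWilsenach2025, Def. 2.2] -/
theorem label_csrc (c : K) (hc : c ∈ LinComb.cset a b) :
    label P a b (csrc c hc : Gate P Y a b) = .const c := by
  unfold csrc
  split_ifs with h
  · exact h.choose_spec
  · rfl

/-- `csrc c` is an input gate. [cite: DawarWilsenach2025, Def. 2.2] -/
theorem children_csrc (c : K) (hc : c ∈ LinComb.cset a b) :
    children P l r a b (csrc c hc) = ∅ := by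
  unfold csrc
  split_ifs with h
  · have h1 : (P.label h.choose).IsInput := by rw [h.choose_spec]; trivial
    simp [children, (P.isInput_iff _).1 h1]
  · rfl

/-! #### Acyclicity -/

/-- Old gates are accessible (acyclicity of `P`). [cite: DawarWilsenach2025, Def. 2.2] -/
theorem acc_old (g : G) :
    Acc (fun s t : Gate P Y a b => s ∈ children P l r a b t) (.old g) := by
  induction g using P.wf.induction with
  | h g ih =>
    refine Acc.intro _ fun s hs => ?_
    simp only [children, Finset.mem_map, LinCombOutGate.oldEmb_apply] at hs
    obtain ⟨h, hh, rfl⟩ := hs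
    exact ih h hh

/-- Gates without children are accessible. [cite: DawarWilsenach2025, Def. 2.2] -/
theorem acc_of_children_eq_empty {s : Gate P Y a b} (h : children P l r a b s = ∅) :
    Acc (fun s t : Gate P Y a b => s ∈ children P l r a b t) s :=
  Acc.intro _ fun t ht => by simp [h] at ht

/-- `sa` is accessible. [cite: DawarWilsenach2025, Def. 2.2] -/
theorem acc_sa : Acc (fun s t : Gate P Y a b => s ∈ children P l r a b t) .sa := by
  refine Acc.intro _ fun s hs => ?_
  simp only [children, Finset.mem_singleton] at hs
  rw [hs]
  exact acc_of_children_eq_empty (children_csrc _ _)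

/-- `sb` is accessible. [cite: DawarWilsenach2025, Def. 2.2] -/
theorem acc_sb : Acc (fun s t : Gate P Y a b => s ∈ children P l r a b t) .sb := by
  refine Acc.intro _ fun s hs => ?_
  simp only [children, Finset.mem_singleton] at hs
  rw [hs]
  exact acc_of_children_eq_empty (children_csrc _ _)

/-- `ma y` is accessible. [cite: DawarWilsenach2025, Def. 2.2] -/
theorem acc_ma (y : Y) : Acc (fun s t : Gate P Y a b => s ∈ children P l r a b t) (.ma y) := by
  refine Acc.intro _ fun s hs => ?_
  simp only [children, Finset.mem_insert, Finset.mem_singleton] at hs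
  rcases hs with rfl | rfl
  · exact acc_sa
  · exact acc_old _

/-- `mb y` is accessible. [cite: DawarWilsenach2025, Def. 2.2] -/
theorem acc_mb (y : Y) : Acc (fun s t : Gate P Y a b => s ∈ children P l r a b t) (.mb y) := by
  refine Acc.intro _ fun s hs => ?_
  simp only [children, Finset.mem_insert, Finset.mem_singleton] at hs
  rcases hs with rfl | rfl
  · exact acc_sb
  · exact acc_old _

/-- `out y` is accessible. [cite: DawarWilsenach2025, Def. 2.2] -/
theorem acc_out (y : Y) : Acc (fun s t : Gate P Y a b => s ∈ children P l r a b t) (.out y) := by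
  refine Acc.intro _ fun s hs => ?_
  simp only [children, Finset.mem_insert, Finset.mem_singleton] at hs
  rcases hs with rfl | rfl
  · exact acc_ma _
  · exact acc_mb _

/-- The child relation of the output-wise linear-combination circuit is well founded.
[cite: DawarWilsenach2025, Def. 2.2] -/
theorem wf : WellFounded fun s t : Gate P Y a b => s ∈ children P l r a b t :=
  ⟨fun s => by
    cases s with
    | old g => exact acc_old g
    | ncst c => exact acc_of_children_eq_empty rfl
    | sa => exact acc_sa
    | sb => exact acc_sb
    | ma y => exact acc_ma y
    | mb y => exact acc_mb y
    | out y => exact acc_out y⟩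

/-! #### The labelled circuit -/

/-- Input labels exactly at the gates without children. [cite: DawarWilsenach2025, Def. 2.2] -/
theorem isInput_iff (s : Gate P Y a b) :
    (label P a b s).IsInput ↔ children P l r a b s = ∅ := by
  cases s with
  | old g => simp only [label, children, Finset.map_eq_empty]; exact P.isInput_iff g
  | ncst c => simp [label, children]
  | sa => simp [label, children, CircuitLabel.IsInput]
  | sb => simp [label, children, CircuitLabel.IsInput]
  | ma y => simp [label, children, CircuitLabel.IsInput]
  | mb y => simp [label, children, CircuitLabel.IsInput]
  | out y => simp [label, children, CircuitLabel.IsInput]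

/-- Labels are injective on input gates. [cite: DawarWilsenach2025, Def. 2.2] -/
theorem eq_of_label_eq (s t : Gate P Y a b) (hs : (label P a b s).IsInput)
    (hst : label P a b s = label P a b t) : s = t := by
  cases s with
  | old g =>
    change (P.label g).IsInput at hs
    cases t with
    | old g' => exact congrArg LinCombOutGate.old (P.eq_of_label_eq g g' hs hst)
    | ncst c => exact absurd hst (c.2.2 g)
    | _ => simp only [label] at hst; rw [hst] at hs; exact absurd hs (by simp)
  | ncst c =>
    cases t with
    | old g => exact absurd hst.symm (c.2.2 g)
    | ncst c' =>
      simp only [label, CircuitLabel.const.injEq] at hst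
      exact congrArg LinCombOutGate.ncst (Subtype.ext hst)
    | _ => simp [label] at hst
  | _ => exact absurd hs (by simp [label])

variable (P l r a b)

/-- **The output-wise linear-combination circuit** over `P` (module docstring): on top of `P`,
the gates computing `a`, `b` and, for every `y ∈ Y`, `a × out_{l y}`, `b × out_{r y}` and the
output `out y = a · out_{l y} + b · out_{r y}`. [cite: DawarWilsenach2025, Def. 2.2] -/
def circuit : LabelledArithCircuit K X Y (Gate P Y a b) where
  children := children P l r a b
  label := label P a b
  output := LinCombOutGate.out
  wf := wf
  isInput_iff := isInput_iff
  eq_of_label_eq := eq_of_label_eq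
  output_injective _ _ h := by cases h; rfl

variable {P l r a b}

/-! ### Semantics -/

section Eval

variable [CommSemiring K]

/-- Old gates keep their values. [cite: DawarWilsenach2025, §2 (evaluation)] -/
theorem eval_old (g : G) : (circuit P l r a b).eval (.old g) = P.eval g := by
  induction g using P.wf.induction with
  | h g ih =>
    have hlab : (circuit P l r a b).label (.old g) = P.label g := rfl
    have hch : (circuit P l r a b).children (.old g) =
        (P.children g).map LinCombOutGate.oldEmb := rfl
    rcases hl : P.label g with x | c | _ | _
    · rw [P.eval_of_label_var hl, (circuit P l r a b).eval_of_label_var (hlab.trans hl)]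
    · rw [P.eval_of_label_const hl, (circuit P l r a b).eval_of_label_const (hlab.trans hl)]
    · rw [P.eval_of_label_add hl, (circuit P l r a b).eval_of_label_add (hlab.trans hl), hch,
        Finset.sum_map]
      exact Finset.sum_congr rfl fun h hh => ih h hh
    · rw [P.eval_of_label_mul hl, (circuit P l r a b).eval_of_label_mul (hlab.trans hl), hch,
        Finset.prod_map]
      exact Finset.prod_congr rfl fun h hh => ih h hh

/-- Constant sources compute their constant. [cite: DawarWilsenach2025, §3.3] -/
theorem eval_csrc (c : K) (hc : c ∈ LinComb.cset a b) :
    (circuit P l r a b).eval (csrc c hc) = MvPolynomial.C c :=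
  (circuit P l r a b).eval_of_label_const (label_csrc c hc)

/-- `sa` computes `a`. [cite: DawarWilsenach2025, §2 (evaluation)] -/
theorem eval_sa : (circuit P l r a b).eval .sa = MvPolynomial.C a := by
  rw [(circuit P l r a b).eval_of_label_add
    (show (circuit P l r a b).label .sa = .add from rfl)]
  change ∑ h ∈ ({csrc a (LinComb.mem_cset a b).1} : Finset (Gate P Y a b)), _ = _
  rw [Finset.sum_singleton, eval_csrc]

/-- `sb` computes `b`. [cite: DawarWilsenach2025, §2 (evaluation)] -/
theorem eval_sb : (circuit P l r a b).eval .sb = MvPolynomial.C b := by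
  rw [(circuit P l r a b).eval_of_label_add
    (show (circuit P l r a b).label .sb = .add from rfl)]
  change ∑ h ∈ ({csrc b (LinComb.mem_cset a b).2} : Finset (Gate P Y a b)), _ = _
  rw [Finset.sum_singleton, eval_csrc]

/-- `ma y` computes `a · out_{l y}`. [cite: DawarWilsenach2025, §2 (evaluation)] -/
theorem eval_ma (y : Y) :
    (circuit P l r a b).eval (.ma y) = MvPolynomial.C a * P.eval (P.output (l y)) := by
  rw [(circuit P l r a b).eval_of_label_mul
    (show (circuit P l r a b).label (.ma y) = .mul from rfl)]
  change ∏ h ∈ ({LinCombOutGate.sa, LinCombOutGate.old (P.output (l y))} :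
    Finset (Gate P Y a b)), _ = _
  rw [Finset.prod_pair (by simp), eval_sa, eval_old]

/-- `mb y` computes `b · out_{r y}`. [cite: DawarWilsenach2025, §2 (evaluation)] -/
theorem eval_mb (y : Y) :
    (circuit P l r a b).eval (.mb y) = MvPolynomial.C b * P.eval (P.output (r y)) := by
  rw [(circuit P l r a b).eval_of_label_mul
    (show (circuit P l r a b).label (.mb y) = .mul from rfl)]
  change ∏ h ∈ ({LinCombOutGate.sb, LinCombOutGate.old (P.output (r y))} :
    Finset (Gate P Y a b)), _ = _
  rw [Finset.prod_pair (by simp), eval_sb, eval_old]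

/-- **Semantics.** The output `y` computes `a · out_{l y} + b · out_{r y}`.
[cite: DawarWilsenach2025, §2 (evaluation)] -/
theorem eval_output (y : Y) :
    (circuit P l r a b).eval ((circuit P l r a b).output y) =
      MvPolynomial.C a * P.eval (P.output (l y)) + MvPolynomial.C b * P.eval (P.output (r y)) := by
  change (circuit P l r a b).eval (.out y) = _
  rw [(circuit P l r a b).eval_of_label_add
    (show (circuit P l r a b).label (.out y) = .add from rfl)]
  change ∑ h ∈ ({LinCombOutGate.ma y, LinCombOutGate.mb y} : Finset (Gate P Y a b)), _ = _
  rw [Finset.sum_pair (by simp), eval_ma, eval_mb]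

end Eval

end LinCombOutputs

end LabelledArithCircuit

end Literature.Computability.AlgebraicComplexity

end
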